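import Summits.BirchSwinnertonDyer.Rank1Residual.X11b.Three.KolyvaginLine
import Summits.BirchSwinnertonDyer.BirchSwinnertonDyer.Theorems.ClassRecordThreeEulerHalvesAtThreeSection6Joined
import HarnessLib

/-!
# The END BRIDGE of the JetchevMaxHL kernel line in the TREE's currency: from the abstract per-level
# inequality (`JET.Section6.tamagawaExponent_le_m_of_selmerFamilies`) and Kolyvagin's redefinition of
# `m_∞` to `Koly.PDiv d p s` for every Kolyvagin–Heegner datum whose conductor has all indices `≥ s`
# — the literal tail of `stub_jetchevMaxHLAtThree` (cell `bsd-stepL`, seat `bsd-stepL-tam3-p1`,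
# helper toward item 19109 `EulerHalvesAtThree`)

HONEST FRAMING. Nothing here proves J₃, Jetchev's Thm. 1.4 at `3 ∥ N`, or divides any Heegner point;
the registered stub `stub_jetchevMaxHLAtThree` (skeleton v4 of item 19109) is NOT discharged; no item
closes; 0 classes move (T7); `--supports stmt-BirchSwinnertonDyer-19109` (helper). WHAT THIS FILE
PINS DOWN: the dictionary between the abstract conductor data `(Λ, M, m', m, m_∞)` of the kernel §6
(`Theorems/Rank1ResidualJetSection6.lean` p471669, `…EulerHalvesAtThreeCoreVertex.lean` p484455,
`…EulerHalvesAtThreeSection6Joined.lean` p484791) and the TREE OBJECTS in which the stub is stated: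
`Λ ↦` pairs `(n, d)` with `d : KolyvaginHeegnerData Dt β ι n` (Gross 1991 ∕ Zhang 2014 data, x11b3),
`M ↦ Zhang2014.levelIndex W p n` (`min_{ℓ ∣ n} M(ℓ)`, `⊤` at `n = 1`), `m' ↦ Koly.divOrd d p`
(McCallum's `ord_p(P_n)` on the derived point `d.derivedPoint`, `X11b/Three/KolyvaginLine.lean`),
the depth statement `s ≤ m'(n)` ↦ `Koly.PDiv d p s` (`P_n ∈ p^s E(K[n])`). With these,
`pDiv_of_perLevel` turns (i) the PER-LEVEL INEQUALITY `hlev` — «for every level `k` and admissible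
conductor `(n, d)` with `m(n) < k`, `t ≤ k`, `k + m(n) ≤ M(n)`: `t ≤ m(n)`», which is the conclusion
of `tamagawaExponent_le_m_of_selmerFamilies` once its level-`p^k` Selmer families are instantiated at
`(n, d)` (the instantiation layer S1∕S2∕S3∕S4∕S5∕S7∕S10 of the `bsd-jet` sheet `PV2-J6-KERNEL.md`
— NOT in the tree) — and (ii) Kolyvagin's redefinition `hK` («`m_∞` is attained at admissible
conductors of arbitrarily large `M(n)`», McCallum 1991 Prop. 5.2 — a PRINTED fact, S9, not typed
here) into `PDiv d p s` for every `s ≤ t`, every square-free `n` all of whose prime factors are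
Kolyvagin primes of index `≥ s`, every datum `d` — i.e. exactly the binder shape
`∀ n d, Squarefree n → (∀ ℓ ∈ n.primeFactors, IsKolyvaginPrime … ℓ ∧ s ≤ kolyvaginIndex W p ℓ) →
PDiv d p s` of the stub (there `p = 3`, `t = ord₃ c_v(E)`). The function `m` (Jetchev's `m(c)`,
§3.1 item 5, or McCallum's convention) is a PARAMETER tied to `divOrd` only through the
convention-insensitive `hm` of p471669. So after this file the stub reads, clause by clause:
`stub ⟸ hK (S9 fact) + hlev (instantiated families)`, everything else kernel.
References (locators only; no cited FACT declared): [cite: Jetchev2008, §3.1 items 4–5 (p. 817),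
Thm. 1.4 (p. 812), Proof of Thm. 1.4 (p. 825)] [cite: McCallumLMS1991, §5 (p. 303) `ord_p(P_n)`,
Prop. 5.2 (p. 304)] [cite: WZhang2014, Notations (xii)]. Design: theorems only; generic odd or even
`p` (pure bookkeeping); `ℕ∞` throughout. Axioms: `propext`, `Classical.choice`, `Quot.sound`.
-/

set_option autoImplicit false

noncomputable section

open scoped Classical

namespace Summit.BirchSwinnertonDyer.Rank1Residual.X11b.Three.Koly

open WeierstrassCurve Literature.NumberTheory.EllipticCurves
  Literature.NumberTheory.EllipticCurves.ModularForms

universe u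

variable {N : ℕ} [NeZero N] {W : WeierstrassCurve ℚ} {K : Type u} [Field K] [NumberField K]
  {Dt : ModularParametrizationData W N} {β : ℤ} {ι : K →+* ℂ}

/-- `ord_p(P_n) ≥ s` in `ℕ∞` means `p^s | P_n`: the supremum defining `Koly.divOrd` is attained
below any finite bound (downward closure `pDiv_mono` + `divOrd_le_of_not_pDiv`). [cite: McCallumLMS1991, §5 (p. 303)] -/
theorem pDiv_of_le_divOrd {n : ℕ} (d : KolyvaginHeegnerData Dt β ι n) (p s : ℕ)
    (h : (s : ℕ∞) ≤ divOrd d p) : PDiv d p s := by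
  by_contra hs
  rcases Nat.eq_zero_or_pos s with rfl | hpos
  · exact hs (pDiv_zero d p)
  · obtain ⟨s', rfl⟩ : ∃ s', s = s' + 1 := ⟨s - 1, by omega⟩
    have h' : divOrd d p ≤ (s' : ℕ∞) := divOrd_le_of_not_pDiv d p hs
    have : ((s' + 1 : ℕ) : ℕ∞) ≤ (s' : ℕ∞) := h.trans h'
    have : s' + 1 ≤ s' := by exact_mod_cast this
    omega

variable [W.IsGloballyMinimal]

omit [NeZero N] in
/-- `s ≤ M(n)` from the index bounds prime by prime (`Zhang2014.natCast_le_levelIndex_iff`). [cite: WZhang2014, Notations (xii)] -/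
theorem natCast_le_levelIndex_of_forall {p s n : ℕ}
    (hℓ : ∀ ℓ ∈ n.primeFactors, s ≤ Zhang2014.kolyvaginIndex W p ℓ) :
    (s : ℕ∞) ≤ Zhang2014.levelIndex W p n :=
  Zhang2014.natCast_le_levelIndex_iff.mpr hℓ

/-- **The end bridge: `PDiv d p s` (the stub's currency) from the per-level inequality and
Kolyvagin's redefinition, over the tree's Kolyvagin–Heegner data.** «Admissible» conductors are the
square-free `n` all of whose prime factors are Kolyvagin primes (`Zhang2014.IsKolyvaginPrime N W K p`);
`m n d : ℕ∞` is any function with `hm : divOrd d p < M(n) → m n d ≤ divOrd d p` on admissible data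
(both printed conventions for `m(c)` qualify) and `hmInf : m_∞ ≤ m n d`; `hK` = Kolyvagin's
redefinition of `m_∞` (McCallum Prop. 5.2: admissible conductors of arbitrarily large `M(n)` attain
`m_∞`); `hlev` = the per-level inequality `t ≤ m(n)` (`m(n) < k`, `t ≤ k`, `k + m(n) ≤ M(n)`), i.e.
the conclusion of `JET.Section6.tamagawaExponent_le_m_of_selmerFamilies` at `(k, n, d)`. CONCLUSION:
for `s ≤ t`, every admissible `n` with all indices `≥ s` and every datum `d`: `p^s | P_n`.
[cite: Jetchev2008, Thm. 1.4 (p. 812) and its proof (p. 825)] [cite: McCallumLMS1991, Prop. 5.2 (p. 304)] -/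
theorem pDiv_of_perLevel (p t mInf : ℕ)
    (m : ∀ n : ℕ, KolyvaginHeegnerData Dt β ι n → ℕ∞)
    (hm : ∀ (n : ℕ) (d : KolyvaginHeegnerData Dt β ι n), Squarefree n →
      (∀ ℓ ∈ n.primeFactors, Zhang2014.IsKolyvaginPrime N W K p ℓ) →
      divOrd d p < Zhang2014.levelIndex W p n → m n d ≤ divOrd d p)
    (hmInf : ∀ (n : ℕ) (d : KolyvaginHeegnerData Dt β ι n), Squarefree n →
      (∀ ℓ ∈ n.primeFactors, Zhang2014.IsKolyvaginPrime N W K p ℓ) → (mInf : ℕ∞) ≤ m n d)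
    (hK : ∀ m' : ℕ, ∃ (n : ℕ) (d : KolyvaginHeegnerData Dt β ι n), Squarefree n ∧
      (∀ ℓ ∈ n.primeFactors, Zhang2014.IsKolyvaginPrime N W K p ℓ) ∧
      (m' : ℕ∞) ≤ Zhang2014.levelIndex W p n ∧ m n d = mInf)
    (hlev : ∀ (k : ℕ) (n : ℕ) (d : KolyvaginHeegnerData Dt β ι n), Squarefree n →
      (∀ ℓ ∈ n.primeFactors, Zhang2014.IsKolyvaginPrime N W K p ℓ) →
      m n d < (k : ℕ∞) → t ≤ k → (k : ℕ∞) + m n d ≤ Zhang2014.levelIndex W p n →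
      (t : ℕ∞) ≤ m n d)
    (s : ℕ) (hs : s ≤ t) (n : ℕ) (d : KolyvaginHeegnerData Dt β ι n) (hn : Squarefree n)
    (hℓ : ∀ ℓ ∈ n.primeFactors,
      Zhang2014.IsKolyvaginPrime N W K p ℓ ∧ s ≤ Zhang2014.kolyvaginIndex W p ℓ) :
    PDiv d p s := by
  -- the admissible conductors with their data, as one index type
  let Λ : Type u := {c : Σ n : ℕ, KolyvaginHeegnerData Dt β ι n //
    Squarefree c.1 ∧ ∀ ℓ ∈ c.1.primeFactors, Zhang2014.IsKolyvaginPrime N W K p ℓ}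
  have hkol : ∀ ℓ ∈ n.primeFactors, Zhang2014.IsKolyvaginPrime N W K p ℓ := fun ℓ h => (hℓ ℓ h).1
  let c₀ : Λ := ⟨⟨n, d⟩, hn, hkol⟩
  have key := JET.Section6.depth_le_mdiv_of_perLevel (Λ := Λ)
    (fun c => Zhang2014.levelIndex W p c.1.1) (fun c => divOrd c.1.2 p) (fun c => m c.1.1 c.1.2)
    (fun c h => hm c.1.1 c.1.2 c.2.1 c.2.2 h) t mInf (fun c => hmInf c.1.1 c.1.2 c.2.1 c.2.2)
    (fun m' => by
      obtain ⟨n', d', hn', hℓ', hM', hm'⟩ := hK m'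
      exact ⟨⟨⟨n', d'⟩, hn', hℓ'⟩, hM', hm'⟩)
    (fun k c h1 h2 h3 => hlev k c.1.1 c.1.2 c.2.1 c.2.2 h1 h2 h3)
    s hs c₀ (natCast_le_levelIndex_of_forall fun ℓ h => (hℓ ℓ h).2)
  exact pDiv_of_le_divOrd d p s key

end Summit.BirchSwinnertonDyer.Rank1Residual.X11b.Three.Koly

end
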